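/-
Origin: expansion seat `planner-pub-hodgecm-pv07-0`, handover 2026-08-18T03:56:07Z (`HOME/pub-hodgecm-pv07/lean/Pv07/SmokeSplit.lean`, md5 05eb9ebb, 75 lines);
landed by the gen-5 packager in gate run 20 as `HodgeCM/PerL34/LocalFactors/SmokeSplit.lean` (import ^import Pv07\.(BallDichotomy|SplitFactor|CompactFactor|KernelRadius|Dictionary|SmokeSplit|SmokeCompact)\b→import HodgeCM.PerL34.LocalFactors.\1 ×1).
-/
/-
Copyright: HodgeCM publication cell (pub-hodgecm), DAG node N31f (prover pv07).
Released under the package licence.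

# N31f — NON-VACUITY SMOKE TEST of the split-place theorem (tex ll. 617–623)

The hypotheses of `HodgeCM.PerL34.LocalFactors.N31f_split_verbatim` are satisfiable by the
INTENDED objects: `F = ℚ_p` (a split place `v` of `L₀ = ℚ` has `L_{0,v} = ℚ_p`), Haar measure on
`ℚ_p³` and on `ℚ_p`, the uniformiser `ϖ = p` (`‖p‖ = p⁻¹ ∈ (0,1)`), `x₀ = (1,1,1)` (`ord x₀ = 0`),
and (for the smoke test) trivial characters `ν = χ'_v = 1`.  Mathlib supplies every instance
(`Padic.instProperSpace`, `Padic.instIsUltrametricDist`, `pi_properSpace`, Haar measure is positive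
on opens and finite on compacts); the only thing Mathlib does not fix globally is a measurable-space
structure on `ℚ_[p]`, so the theorem below is stated over `[MeasurableSpace ℚ_[p]] [BorelSpace ℚ_[p]]`
and `borel_padic_exists` shows these two binders are inhabited (by the Borel σ-algebra).
Nothing here is an input of the package; it only certifies that N31f's packaged statement is not
vacuous.
-/
import Summits.HodgeConjecture.HodgeCM.PerL34.LocalFactors.Dictionary

/-! PORT of `HodgeCM/PerL34/LocalFactors/SmokeSplit.lean` (HodgeCMPerL run 82) — verbatim mechanical port; provenance in the PORT header line. -/

namespace HodgeCM
namespace PerL34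
namespace LocalFactors
namespace Smoke

open Metric Set MeasureTheory
open scoped Pointwise

/-- The two instance binders of `N31f_split_smoke` are inhabited: the Borel σ-algebra. -/
theorem borel_padic_exists (p : ℕ) [Fact p.Prime] :
    ∃ m : MeasurableSpace ℚ_[p], @BorelSpace ℚ_[p] _ m :=
  ⟨borel _, @BorelSpace.mk ℚ_[p] _ (borel _) rfl⟩

variable (p : ℕ) [hp : Fact p.Prime]

/-- `0 < ‖p‖_p`. -/
theorem norm_p_pos : 0 < ‖(p : ℚ_[p])‖ := by
  rw [Padic.norm_p]
  have : (0 : ℝ) < p := by exact_mod_cast hp.out.pos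
  positivity

/-- `‖p‖_p < 1`. -/
theorem norm_p_lt_one : ‖(p : ℚ_[p])‖ < 1 := by
  rw [Padic.norm_p]
  exact inv_lt_one_of_one_lt₀ (by exact_mod_cast hp.out.one_lt)

variable [MeasurableSpace ℚ_[p]] [BorelSpace ℚ_[p]]

/-- **Smoke instance of N31f (split place).**  With `F = ℚ_p`, Haar measures, `ϖ = p`,
`x₀ = (1,1,1) ∈ ℚ_p³`, `ν = χ' = 1`: for all large `N`, `0 < N` (= `N > ord x₀ = 0`),
`D = closedBall x₀ (p^{-N}) = x₀ + p^N ℤ_p³`, `U₁ = 1 + p^N ℤ_p`, and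
`I_v(𝟙_D) = ∫ |y|^{3/2} vol(D ∩ y⁻¹D) dy = c > 0`. -/
theorem N31f_split_smoke :
    ∃ N₀ : ℕ, ∀ N, N₀ ≤ N →
      0 < N ∧
      closedBall (1 : Fin 3 → ℚ_[p]) (‖(p : ℚ_[p])‖ ^ N)
          = (1 : Fin 3 → ℚ_[p]) +ᵥ ((p : ℚ_[p]) ^ N) • closedBall (0 : Fin 3 → ℚ_[p]) 1 ∧
      U1 (1 : Fin 3 → ℚ_[p]) (‖(p : ℚ_[p])‖ ^ N)
          = (1 : ℚ_[p]) +ᵥ ((p : ℚ_[p]) ^ (N - 0)) • closedBall (0 : ℚ_[p]) 1 ∧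
      ∃ c : ℝ, 0 < c ∧
        ∫ y, ballCoeff (dilationWeight (1 : ℚ_[p] → Circle)) (Measure.addHaar)
            (1 : Fin 3 → ℚ_[p]) (‖(p : ℚ_[p])‖ ^ N) y * (((1 : ℚ_[p] → Circle) y : Circle) : ℂ)
          ∂(Measure.addHaar : Measure ℚ_[p]) = (c : ℂ) := by
  have hx : ‖(1 : Fin 3 → ℚ_[p])‖ = ‖(p : ℚ_[p])‖ ^ 0 := by rw [pow_zero, norm_one]
  have hmul : ∀ y z : ℚ_[p], y ≠ 0 → z ≠ 0 →
      (1 : ℚ_[p] → Circle) (y * z) = (1 : ℚ_[p] → Circle) y * (1 : ℚ_[p] → Circle) z := by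
    intro y z _ _
    simp
  have hcont : ContinuousAt (1 : ℚ_[p] → Circle) 1 := continuousAt_const
  exact N31f_split_verbatim (μ := (Measure.addHaar : Measure (Fin 3 → ℚ_[p])))
    (Measure.addHaar : Measure ℚ_[p]) 1 1 hmul hcont hmul hcont (norm_p_pos p) (norm_p_lt_one p) hx

end Smoke
end LocalFactors
end PerL34
end HodgeCM
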